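import Summits.FinalStateConjecture.FinalStateConjecture.Theorems.SeamedChartsExhaust.Negative.KerrSchildTimeFunction
import Literature.Geometry.Lorentzian.KerrConvergenceProofs
import Literature.Geometry.Lorentzian.CausalFutureProofs

/-!
# Continuity of the certified radii is load-bearing for the first-contact stub
# (negative-side support for crux `stmt-FinalStateConjecture-13551`, route `StarvedNecks`, line `wide-anchoring`)

The landed theorem `Theorems.SeamedChartsExhaust.WideAnchoring.stub_firstContact` (p76467; the FIRST
CONTACT stub of the picked line `Cruxes/SeamedChartsExhaust/Lines/wide-anchoring.lean`) has three
hypotheses: `hd` (HonestCore (d): the flat chart is future oriented), `hR` (SEAMED (1): every certified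
radius `Rᵢ` is continuous) and `h8` (SEAMED (8): flat tubes lie deep inside certified tubes). `hd` and
`h8` are known to be load-bearing (`Negative/WithoutFutureOrientation.lean`; the disprover's
`not_firstContact_without_seamed8`). This file shows that `hR` is load-bearing too:
`not_firstContact_without_continuity` — the stub's statement with `hR` deleted is FALSE.

Why a new model is needed (record correction). SEAMED (8) forces `Rⱼ(s) ≥ ρⱼ(s) + 2` at every hole
time `s` whose flat-tube slice is non-empty, so the "step profile `R = 0` below a threshold" witness
proposed on paper in `Cruxes/SeamedChartsExhaust/DrefuteG3.md` violates (8). Conversely, if SOME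
continuous `R' ≤ R` satisfies (8) the `hR`-less statement follows from the landed theorem applied to
`R'` (its LEFT disjunct does not mention `R`, its RIGHT disjunct is monotone in `R`). Hence a
counter-model must make the lower envelope `s ↦ ρⱼ(s) + 2` itself discontinuous, i.e. it needs a
DISCONTINUOUS EXCISION RADIUS — which `FinalStateDecomposition` allows (`excision` is only required to
be sublinear, `ρ(t)/t → 0`).

The model `JumpModel`: the exact Schwarzschild exterior `Kerr.spacetime 1 0 2` (`{r > 2}`, mass `1`),
`N = 1`, motion `(1, 0)`, identity hole chart, identity flat chart on
`U = {x⁰ > −1, r > ρ(x⁰)}` with the JUMPING tube radius `ρ(t) = 101 + √t + 10·𝟙[1 ≤ t]` (upper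
semicontinuous, so `U` is open), `τ₀ = 0`; radii `R := ρ + 2` (so (8) holds with equality; `R` jumps at
hole time `1`). Take `τ₁ = 1` and the flat-late point `y = (1/4, 105.5, 0, 0)` (`r(y) = ρ(1/4) + 4`).
Kerr–Schild light cones lie inside the Minkowski cones (`KerrCone.exists_norm_spatial_sub_le_of_mem_causalPast`,
finite speed of light), so every `c ≥ y` with `c⁰ ≤ 1` has `104.75 ≤ r(c) ≤ 106.25`: the flat slab
`{x⁰ = 1} ∩ U ⊆ {r > 112}` is out of reach (LEFT fails), no `c` with `c⁰ < 1` is a contact point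
(`R(c⁰) ≤ 104`), and a `c ∈ U` with `c⁰ = 1` would need `r(c) > 112` (RIGHT fails).

The Schwarzschild chart bookkeeping (`ST`, `ΨK`, `Ψ`, `Φ`, `O`, `decomp`, …) follows the disprover's
exact Schwarzschild model (`Cruxes/SeamedChartsExhaust/Disproof.lean` §5, cdisprove cycle 2,
refuter-cdisprove-stmt-FinalStateConjecture-13551-g2-0), specialised to mass `1` and the jumping `ρ`; the
cone lemmas of `KerrCone` reproduce its §6. Landed part used by import:
`Negative/KerrSchildTimeFunction.lean` (`KerrTime.*`, `Schw.*`).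

References: M. Dafermos, I. Rodnianski, *Lectures on black holes and linear waves*, arXiv:0811.0354,
§5.1; B. O'Neill, *Semi-Riemannian geometry*, Academic Press 1983, Ch. 14, pp. 402–403;
M. Dafermos, G. Holzegel, I. Rodnianski, M. Taylor, arXiv:2104.08222, §1.
-/

noncomputable section

open TopologicalSpace Manifold Filter Topology Set Function
open scoped ContDiff Topology ENNReal Manifold

set_option linter.dupNamespace false

-- instance search through nested operator types `E4 →L E4 →L E4 →L ℝ` (as in the tree files)
set_option maxSynthPendingDepth 3

namespace Summit.FinalStateConjecture.FinalStateConjecture.Theorems.SeamedChartsExhaust.Negative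

open Literature.Geometry.Lorentzian LorentzianMetric

/-- `Kerr.Facts` is inhabited (all three fields are theorems in the tree). [folklore] -/
instance jumpModelKerrFacts : Kerr.Facts :=
  ⟨Kerr.isConnected_region_holds, Kerr.contMDiff_bilin_holds, Kerr.contMDiff_timeVector_holds⟩

/-! ## Kerr–Schild light cones lie inside the Minkowski cones (`M ≥ 0`) -/

namespace KerrCone

variable {M a r₀ : ℝ} {hM : 0 ≤ M}

/-- `η(v, v) = −(v⁰)² + ‖v̲‖²`. O'Neill 1983, Ch. 3, p. 55. [folklore] -/
theorem minkowski_bilin_self (v : E4) : Minkowski.bilin v v = -(v 0) ^ 2 + E4.spatialNorm v ^ 2 := by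
  rw [Minkowski.bilin_apply, E4.spatialNorm_sq, Fin.sum_univ_three]
  simp only [Fin.succ_zero_eq_one, Fin.succ_one_eq_two]
  have h3 : (2 : Fin 3).succ = (3 : Fin 4) := rfl
  rw [h3]
  ring

set_option backward.isDefEq.respectTransparency false in
/-- Chain rule for a continuous linear functional `L` along a differentiable curve in the Kerr–Schild
patch: `L ∘ γ` has derivative `L(γ')`. [folklore] -/
theorem hasDerivAt_clm_comp (L : E4 →L[ℝ] ℝ) {γ : ℝ → (Kerr.spacetime M a r₀ hM).carrier} {s : ℝ}
    (hγ : MDifferentiableAt 𝓘(ℝ, ℝ) (𝓡 4) γ s) :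
    HasDerivAt (fun s ↦ L (γ s).1) (L (show E4 from velocity (𝓡 4) γ s)) s := by
  have hφ : HasMFDerivAt (𝓡 4) 𝓘(ℝ, ℝ)
      (fun x : (Kerr.spacetime M a r₀ hM).carrier ↦ L x.1) (γ s)
      (L.comp (ContinuousLinearMap.id ℝ E4)) :=
    L.hasMFDerivAt.comp (γ s) (hasMFDerivAt_subtypeVal (I' := 𝓡 4) (γ s))
  rw [hasDerivAt_iff_hasFDerivAt, ← hasMFDerivAt_iff_hasFDerivAt]
  apply (hφ.comp s hγ.hasMFDerivAt).congr_mfderiv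
  rw [ContinuousLinearMap.ext_iff]
  intro (r : ℝ)
  have hr : (mfderiv 𝓘(ℝ, ℝ) (𝓡 4) γ s) r = r • (mfderiv 𝓘(ℝ, ℝ) (𝓡 4) γ s) (1 : ℝ) := by
    rw [← map_smul]
    congr 1
    exact (mul_one r).symm
  change L ((mfderiv 𝓘(ℝ, ℝ) (𝓡 4) γ s) r) = r • L (show E4 from velocity (𝓡 4) γ s)
  rw [hr, map_smul, smul_eq_mul, smul_eq_mul]
  rfl

/-- **Kerr–Schild cones lie inside the Minkowski cones** (`M ≥ 0`): a `g`-causal vector is `η`-causal,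
`‖v̲‖ ≤ |v⁰|`, since `g(v, v) = η(v, v) + 2H ℓ(v)²` with `H ≥ 0`. Dafermos–Rodnianski arXiv:0811.0354,
§5.1. [folklore] -/
theorem spatialNorm_le_abs_of_isCausal {x : (Kerr.spacetime M a r₀ hM).carrier} {v : E4}
    (hv : (Kerr.spacetime M a r₀ hM).metric.IsCausal (x := x) v) : E4.spatialNorm v ≤ |v 0| := by
  have hc : Kerr.bilin M a x.1 v v ≤ 0 := hv.1
  rw [Kerr.bilin_apply, minkowski_bilin_self] at hc
  have hH := Kerr.scalarH_nonneg hM a x.1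
  have hl : 0 ≤ Kerr.nullCovector a x.1 v * Kerr.nullCovector a x.1 v := mul_self_nonneg _
  have hsq : E4.spatialNorm v ^ 2 ≤ |v 0| ^ 2 := by rw [sq_abs]; nlinarith
  have h1 := Real.sqrt_le_sqrt hsq
  rwa [Real.sqrt_sq (E4.spatialNorm_nonneg v), Real.sqrt_sq (abs_nonneg _)] at h1

/-- Along a past-directed causal curve, for every `e ∈ E3` with `‖e‖ ≤ 1` the function
`s ↦ −x⁰(γ s) + ⟨e, x̲(γ s)⟩` is monotone (`−v⁰ + ⟨e, v̲⟩ ≥ −v⁰ − ‖v̲‖ ≥ 0`). [folklore] -/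
theorem monotoneOn_neg_time_add_inner {γ : ℝ → (Kerr.spacetime M a r₀ hM).carrier} {s₁ s₂ : ℝ}
    (hγ : (Kerr.spacetime M a r₀ hM).metric.IsFutureCausalCurveOn
      (Kerr.spacetime M a r₀ hM).timeOrientation.reverse γ (Icc s₁ s₂)) (e : E3) (he : ‖e‖ ≤ 1) :
    MonotoneOn (fun s ↦ -(γ s).1 0 + inner ℝ e (E4.spatial (γ s).1)) (Icc s₁ s₂) := by
  set L : E4 →L[ℝ] ℝ := -EuclideanSpace.proj (0 : Fin 4) + (innerSL ℝ e).comp E4.spatial with hL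
  have hLv : ∀ v : E4, L v = -v 0 + inner ℝ e (E4.spatial v) := fun v ↦ by simp [hL]
  have hcont : ContinuousOn (fun s ↦ L (γ s).1) (Icc s₁ s₂) := fun s hs ↦
    ((L.continuous.comp continuous_subtype_val).continuousAt.comp (hγ.continuousAt hs)).continuousWithinAt
  have key : MonotoneOn (fun s ↦ L (γ s).1) (Icc s₁ s₂) := by
    refine monotoneOn_of_hasDerivWithinAt_nonneg (convex_Icc s₁ s₂) hcont
      (fun s hs ↦ (hasDerivAt_clm_comp L (hγ s (interior_subset hs)).1).hasDerivWithinAt) fun s hs ↦ ?_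
    have hfd := (hγ s (interior_subset hs)).2
    set v : E4 := (show E4 from velocity (𝓡 4) γ s) with hv
    have h0 : v 0 < 0 := KerrTime.velocity_zero_neg hfd
    have hsp : E4.spatialNorm v ≤ |v 0| := by
      rw [TimeOrientation.isFutureDirected_reverse_iff] at hfd
      exact spatialNorm_le_abs_of_isCausal hfd.1
    rw [abs_of_neg h0] at hsp
    have hin : |inner ℝ e (E4.spatial v)| ≤ E4.spatialNorm v := by
      refine (abs_real_inner_le_norm e _).trans ?_
      rw [E4.spatialNorm]
      exact mul_le_of_le_one_left (norm_nonneg _) he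
    show (0 : ℝ) ≤ L v
    rw [hLv]
    linarith [neg_abs_le (inner ℝ e (E4.spatial v))]
  simpa only [hLv] using key

/-- **Finite speed of light in Kerr–Schild coordinates** (`M ≥ 0`): if `p ∈ J⁻(S)` then some `q ∈ S`
has `‖q̲ − p̲‖ ≤ q⁰ − p⁰`. Dafermos–Rodnianski arXiv:0811.0354, §5.1. [folklore] -/
theorem exists_norm_spatial_sub_le_of_mem_causalPast {S : Set (Kerr.spacetime M a r₀ hM).carrier}
    {p : (Kerr.spacetime M a r₀ hM).carrier}
    (hp : p ∈ (Kerr.spacetime M a r₀ hM).metric.causalPast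
      (Kerr.spacetime M a r₀ hM).timeOrientation S) :
    ∃ q ∈ S, ‖E4.spatial q.1 - E4.spatial p.1‖ ≤ q.1 0 - p.1 0 := by
  rcases hp with hp | ⟨q, hq, γ, s₁, s₂, hs, hγ, hγ₁, hγ₂⟩
  · exact ⟨p, hp, by simp⟩
  · refine ⟨q, hq, ?_⟩
    have hine : ∀ e : E3, ‖e‖ ≤ 1 → inner ℝ e (E4.spatial q.1 - E4.spatial p.1) ≤ q.1 0 - p.1 0 := by
      intro e he
      have hmono := monotoneOn_neg_time_add_inner hγ e he ⟨le_rfl, hs.le⟩ ⟨hs.le, le_rfl⟩ hs.le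
      simp only at hmono
      rw [hγ₁, hγ₂] at hmono
      rw [inner_sub_right]
      linarith
    set w : E3 := E4.spatial q.1 - E4.spatial p.1 with hw
    by_cases hw0 : w = 0
    · have h := hine 0 (by simp)
      rw [hw0, norm_zero]
      simpa using h
    · have hn : 0 < ‖w‖ := norm_pos_iff.mpr hw0
      have he : ‖‖w‖⁻¹ • w‖ ≤ 1 := by
        rw [norm_smul, norm_inv, norm_norm, inv_mul_cancel₀ hn.ne']
      have h := hine _ he
      rwa [real_inner_smul_left, real_inner_self_eq_norm_sq, pow_two, ← mul_assoc,
        inv_mul_cancel₀ hn.ne', one_mul] at h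

end KerrCone

/-! ## The jump model: exact Schwarzschild (mass 1, exterior patch), flat tube radius jumping at `t = 1` -/

namespace JumpModel

/-- The ambient spacetime: the Schwarzschild Kerr–Schild exterior patch `{r > 2}` of mass `1`. -/
def ST : Spacetime.{0} 4 := Kerr.spacetime 1 0 2 zero_le_one

/-- The continuous part `101 + √t` of the tube radius. -/
def base (t : ℝ) : ℝ := 101 + √t

/-- The JUMPING flat tube radius `ρ(t) = 101 + √t + 10·𝟙[1 ≤ t]` (upper semicontinuous, sublinear). -/
def ρ (t : ℝ) : ℝ := base t + if 1 ≤ t then 10 else 0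

/-- The radii `R(s) = ρ(s) + 2` (the least profile SEAMED (8) allows; discontinuous at `s = 1`). -/
def Rj (s : ℝ) : ℝ := ρ s + 2

theorem continuous_base : Continuous base := continuous_const.add Real.continuous_sqrt

theorem base_le_ρ (t : ℝ) : base t ≤ ρ t := by
  unfold ρ; split_ifs <;> linarith

theorem ρ_ge (t : ℝ) : 101 ≤ ρ t := by
  have h : 101 ≤ base t := le_add_of_nonneg_right (Real.sqrt_nonneg t)
  exact h.trans (base_le_ρ t)

theorem ρ_pos (t : ℝ) : 0 < ρ t := by linarith [ρ_ge t]

theorem two_lt_ρ (t : ℝ) : 2 * (1 : ℝ) < ρ t := by linarith [ρ_ge t]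

theorem ρ_of_lt_one {t : ℝ} (ht : t < 1) : ρ t = base t := by
  unfold ρ; rw [if_neg (not_le.mpr ht), add_zero]

theorem ρ_of_one_le {t : ℝ} (ht : 1 ≤ t) : ρ t = base t + 10 := by
  unfold ρ; rw [if_pos ht]

/-- `ρ(1/4) = 101.5`. -/
theorem ρ_quarter : ρ (1 / 4) = 203 / 2 := by
  rw [ρ_of_lt_one (by norm_num), base]
  have : √(1 / 4 : ℝ) = 1 / 2 := by
    rw [show (1 / 4 : ℝ) = (1 / 2) ^ 2 by norm_num, Real.sqrt_sq (by norm_num)]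
  rw [this]; norm_num

/-- `ρ(1) = 112`. -/
theorem ρ_one : ρ 1 = 112 := by
  rw [ρ_of_one_le le_rfl, base, Real.sqrt_one]; norm_num

/-- Below hole time `1` the radii are at most `104`. -/
theorem Rj_le_of_lt_one {s : ℝ} (hs : s < 1) : Rj s ≤ 104 := by
  rw [Rj, ρ_of_lt_one hs, base]
  have h1 : √s ≤ 1 := by
    rcases le_or_gt 0 s with h | h
    · calc √s ≤ √1 := Real.sqrt_le_sqrt hs.le
        _ = 1 := Real.sqrt_one
    · rw [Real.sqrt_eq_zero'.mpr h.le]; norm_num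
  linarith

/-- The flat coordinate domain `U = {x⁰ > −1, r > ρ(x⁰)}`, written as a union of two open sets
(`ρ` is upper semicontinuous: it jumps UP at `t = 1` and takes the upper value there). -/
theorem isOpen_U : IsOpen {x : E4 | -1 < x 0 ∧ ρ (x 0) < Kerr.radius 0 x} := by
  have hc0 : Continuous fun x : E4 ↦ x 0 := PiLp.continuous_apply 2 _ 0
  have hb : Continuous fun x : E4 ↦ base (x 0) := continuous_base.comp hc0
  have hEq : {x : E4 | -1 < x 0 ∧ ρ (x 0) < Kerr.radius 0 x} =
      ({x : E4 | -1 < x 0} ∩ {x | x 0 < 1} ∩ {x | base (x 0) < Kerr.radius 0 x}) ∪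
        ({x : E4 | -1 < x 0} ∩ {x | base (x 0) + 10 < Kerr.radius 0 x}) := by
    ext x
    simp only [mem_setOf_eq, mem_union, mem_inter_iff]
    by_cases h : 1 ≤ x 0
    · rw [ρ_of_one_le h]
      constructor
      · rintro ⟨h1, h2⟩; exact Or.inr ⟨h1, h2⟩
      · rintro (⟨⟨h1, h2⟩, -⟩ | ⟨h1, h2⟩)
        · exact absurd h2 (not_lt.mpr h)
        · exact ⟨h1, h2⟩
    · push Not at h
      rw [ρ_of_lt_one h]
      constructor
      · rintro ⟨h1, h2⟩; exact Or.inl ⟨⟨h1, h⟩, h2⟩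
      · rintro (⟨⟨h1, -⟩, h2⟩ | ⟨h1, h2⟩)
        · exact ⟨h1, h2⟩
        · exact ⟨h1, by linarith⟩
  rw [hEq]
  refine (((isOpen_lt continuous_const hc0).inter (isOpen_lt hc0 continuous_const)).inter
    (isOpen_lt hb (Kerr.continuous_radius 0))).union
    ((isOpen_lt continuous_const hc0).inter (isOpen_lt (hb.add continuous_const) (Kerr.continuous_radius 0)))

/-- The flat coordinate domain `U = {x⁰ > −1, r > ρ(x⁰)}`. -/
def U : Opens E4 := ⟨{x | -1 < x 0 ∧ ρ (x 0) < Kerr.radius 0 x}, isOpen_U⟩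

theorem mem_U {x : E4} : x ∈ U ↔ -1 < x 0 ∧ ρ (x 0) < Kerr.radius 0 x := Iff.rfl

theorem rPlus_eq : Kerr.rPlus 1 0 = 2 * (1 : ℝ) := Kerr.rPlus_zero_right zero_le_one

theorem hext : (Kerr.background 1 0).domain ≤ Kerr.region 0 2 := by
  change Kerr.region 0 (Kerr.rPlus 1 0) ≤ Kerr.region 0 2
  rw [rPlus_eq, mul_one]

theorem mem_exterior_iff {x : E4} : x ∈ Kerr.exterior 1 0 ↔ 2 * (1 : ℝ) < Kerr.radius 0 x := by
  rw [Kerr.mem_exterior, rPlus_eq, max_eq_left (by norm_num)]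

theorem mem_bext_iff {x : E4} : x ∈ boostedKerrExterior 1 0 1 0 ↔ 2 * (1 : ℝ) < Kerr.radius 0 x := by
  rw [mem_boostedKerrExterior, poincareInv_one_zero, mem_exterior_iff]

theorem hbext : boostedKerrExterior 1 0 1 0 ≤ Kerr.region 0 2 := by
  rw [boostedKerrExterior_one_zero]
  exact hext

theorem hUext : (Minkowski.backgroundOn U).domain ≤ (Kerr.background 1 0).domain := by
  intro x hx
  change x ∈ Kerr.exterior 1 0
  rw [mem_exterior_iff]
  exact (two_lt_ρ (x 0)).trans hx.2

theorem hUreg : U ≤ Kerr.region 0 2 := fun _ hx ↦ hext (hUext hx)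

/-- The identity Kerr chart `{r > 2} ↪ {r > 2}`. -/
def ΨK : (Kerr.background 1 0).domain → ST.carrier := Opens.inclusion hext

/-- The hole chart: the identity on the boosted exterior of the trivial motion `(1, 0)`. -/
def Ψ : (boostedKerrBackground 1 0 1 0).domain → ST.carrier := Opens.inclusion hbext

/-- The flat chart: the identity Kerr chart restricted to `U`. -/
def Φ : (Minkowski.backgroundOn U).domain → ST.carrier := ΨK ∘ Opens.inclusion hUext

/-- The region: the Schwarzschild exterior `{r > 2}` (all of the patch). -/
def O : Set ST.carrier := {x | 2 * (1 : ℝ) < Kerr.radius 0 x.1}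

@[simp] theorem Ψ_val (x : (boostedKerrBackground 1 0 1 0).domain) : (Ψ x).1 = x.1 := rfl
@[simp] theorem ΨK_val (x : (Kerr.background 1 0).domain) : (ΨK x).1 = x.1 := rfl
@[simp] theorem Φ_val (y : (Minkowski.backgroundOn U).domain) : (Φ y).1 = y.1 := rfl

theorem mem_O {x : ST.carrier} : x ∈ O ↔ 2 * (1 : ℝ) < Kerr.radius 0 x.1 := Iff.rfl

/-- The deviation of the identity hole chart from boosted Kerr `(1, 0)` vanishes identically. -/
theorem deviation_Ψ (x : (boostedKerrBackground 1 0 1 0).domain) :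
    ST.deviation (boostedKerrBackground 1 0 1 0) Ψ x = 0 := by
  ext v w
  rw [Spacetime.deviation_apply]
  have e1 : mfderiv 𝓘(ℝ, E4) (𝓡 4) Ψ x v = v := OpensChart.mfderiv_inclusion_apply hbext x v
  have e2 : mfderiv 𝓘(ℝ, E4) (𝓡 4) Ψ x w = w := OpensChart.mfderiv_inclusion_apply hbext x w
  rw [e1, e2]
  change Kerr.bilin 1 0 x.1 v w - boostedKerrBilin 1 0 1 0 x.1 v w = 0
  rw [boostedKerrBilin_one_zero]
  exact sub_self _

theorem deviationExtend_Ψ : ST.deviationExtend (boostedKerrBackground 1 0 1 0) Ψ = 0 := by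
  funext z
  by_cases hz : z ∈ (boostedKerrBackground 1 0 1 0).domain
  · have := ST.deviationExtend_coe (boostedKerrBackground 1 0 1 0) Ψ ⟨z, hz⟩
    rw [deviation_Ψ] at this
    exact this
  · exact ST.deviationExtend_of_not_mem _ _ hz

/-- The deviation of the identity Kerr chart from Kerr vanishes identically. -/
theorem deviation_ΨK (x : (Kerr.background 1 0).domain) :
    ST.deviation (Kerr.background 1 0) ΨK x = 0 := by
  ext v w
  rw [Spacetime.deviation_apply]
  have e1 : mfderiv 𝓘(ℝ, E4) (𝓡 4) ΨK x v = v := OpensChart.mfderiv_inclusion_apply hext x v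
  have e2 : mfderiv 𝓘(ℝ, E4) (𝓡 4) ΨK x w = w := OpensChart.mfderiv_inclusion_apply hext x w
  rw [e1, e2]
  exact sub_self _

theorem deviationExtend_ΨK : ST.deviationExtend (Kerr.background 1 0) ΨK = 0 := by
  funext z
  by_cases hz : z ∈ (Kerr.background 1 0).domain
  · have := ST.deviationExtend_coe (Kerr.background 1 0) ΨK ⟨z, hz⟩
    rw [deviation_ΨK] at this
    exact this
  · exact ST.deviationExtend_of_not_mem _ _ hz

/-- Late-time chart property of an inclusion of open subsets of `E4` into the patch. -/
theorem isLateChart_inclusion (B : ModelBackground) (hV : B.domain ≤ Kerr.region 0 2)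
    (htime : Continuous B.time)
    (hO : ∀ x : B.domain, 0 < B.time x.1 → 2 * (1 : ℝ) < Kerr.radius 0 x.1) :
    ST.IsLateChart B O 0 (Opens.inclusion hV : B.domain → ST.carrier) := by
  refine ⟨contMDiff_inclusion (n := ∞) hV, ?_, ?_⟩
  · have hlate : IsOpen (B.lateRegion 0) :=
      isOpen_lt continuous_const (htime.comp continuous_subtype_val)
    have hg : IsOpenEmbedding (fun x : B.lateRegion 0 ↦ (x.1.1 : E4)) :=
      B.domain.2.isOpenEmbedding_subtypeVal.comp hlate.isOpenEmbedding_subtypeVal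
    have hcar : IsOpenEmbedding (Subtype.val : ST.carrier → E4) :=
      (Kerr.region 0 2).2.isOpenEmbedding_subtypeVal
    exact IsOpenEmbedding.of_comp _ hcar hg
  · rintro _ ⟨x, hx, rfl⟩
    exact hO x hx

theorem isLateChart_ΨK : ST.IsLateChart (Kerr.background 1 0) O 0 ΨK :=
  isLateChart_inclusion _ hext (PiLp.continuous_apply 2 _ 0) fun x _ ↦ mem_exterior_iff.mp x.2

theorem isLateChart_Ψ : ST.IsLateChart (boostedKerrBackground 1 0 1 0) O 0 Ψ :=
  isLateChart_inclusion _ hbext ((PiLp.continuous_apply 2 _ 0).comp (continuous_poincareInv 1 0))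
    fun x _ ↦ mem_bext_iff.mp x.2

theorem isLateChart_Φ : ST.IsLateChart (Minkowski.backgroundOn U) O 0 Φ :=
  ST.isLateChart_backgroundOn_comp_inclusion isLateChart_ΨK hUext

theorem deviationCk_ΨK (k : ℕ) (τ : ℝ) : ST.deviationCk (Kerr.background 1 0) ΨK k τ = 0 := by
  rw [Spacetime.deviationCk, deviationExtend_ΨK, supCkENorm_zero]

theorem truncDeviationCk_Ψ (k : ℕ) (R τ : ℝ) :
    ST.truncDeviationCk (boostedKerrBackground 1 0 1 0) Ψ k R τ = 0 := by
  rw [Spacetime.truncDeviationCk, deviationExtend_Ψ, supCkENorm_zero]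

theorem base_tendsto_atTop : Tendsto base atTop atTop :=
  tendsto_atTop_add_const_left _ _ Real.tendsto_sqrt_atTop

theorem ρ_tendsto_atTop : Tendsto ρ atTop atTop :=
  tendsto_atTop_mono base_le_ρ base_tendsto_atTop

/-- Sublinearity of the jumping radius: `ρ(t)/t → 0`. -/
theorem ρ_div_tendsto : Tendsto (fun t ↦ ρ t / t) atTop (𝓝 0) := by
  have h1 : Tendsto (fun t : ℝ ↦ (111 : ℝ) / t) atTop (𝓝 0) :=
    tendsto_const_nhds.div_atTop tendsto_id
  have h2 : Tendsto (fun t : ℝ ↦ √t / t) atTop (𝓝 0) := by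
    simp_rw [Real.sqrt_div_self]
    exact tendsto_inv_atTop_zero.comp Real.tendsto_sqrt_atTop
  have := h1.add h2
  simp only [add_zero] at this
  refine this.congr' ?_
  filter_upwards [eventually_ge_atTop (1 : ℝ)] with t ht
  rw [ρ_of_one_le ht, base]
  ring

/-- Vertical displacement inside the patch keeps the radius. -/
theorem mem_region_add_smul (x : ST.carrier) (s : ℝ) :
    x.1 + s • E4.basisVector 0 ∈ Kerr.region 0 2 := by
  show max 2 0 < Kerr.radius 0 (x.1 + s • E4.basisVector 0)
  rw [Kerr.radius_add_time_smul_basisVector]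
  exact x.2

/-- The vertical translate `x + s ∂₀` as a point of the patch. -/
def up (x : ST.carrier) (s : ℝ) : ST.carrier := ⟨x.1 + s • E4.basisVector 0, mem_region_add_smul x s⟩

@[simp] theorem up_val (x : ST.carrier) (s : ℝ) : (up x s).1 = x.1 + s • E4.basisVector 0 := rfl
theorem up_zero_apply (x : ST.carrier) (s : ℝ) : (up x s).1 0 = x.1 0 + s := by simp [up]
theorem radius_up (x : ST.carrier) (s : ℝ) : Kerr.radius 0 (up x s).1 = Kerr.radius 0 x.1 :=
  Kerr.radius_add_time_smul_basisVector _ _ _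

theorem up_mem_causalFuture (x : ST.carrier) (hx : x ∈ O) {s : ℝ} (hs : 0 ≤ s) :
    up x s ∈ ST.metric.causalFuture ST.timeOrientation {x} :=
  Schw.vertical_mem_causalFuture (hM := zero_le_one) x hx hs _

theorem mem_causalPast_up (x : ST.carrier) (hx : x ∈ O) {s : ℝ} (hs : 0 ≤ s) :
    x ∈ ST.metric.causalPast ST.timeOrientation {up x s} :=
  mem_causalPast_of_mem_causalFuture (up_mem_causalFuture x hx hs)

/-- A point of the exterior with coordinate `y ∈ E4` is the hole-chart image of `y`. -/
theorem eq_Ψ (x : ST.carrier) (hx : x ∈ O) :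
    ∃ hx' : x.1 ∈ (boostedKerrBackground 1 0 1 0).domain, Ψ ⟨x.1, hx'⟩ = x :=
  ⟨mem_bext_iff.mpr hx, Subtype.ext rfl⟩

/-- The `N = 1` exact Schwarzschild decomposition of the exterior `O = {r > 2}`: motion `(1, 0)`,
identity hole chart, flat chart the identity on `U = {x⁰ > −1, r > ρ(x⁰)}` with the JUMPING excision
radius `ρ`, `τ₀ = 0`. -/
def decomp : FinalStateDecomposition ST O 2 where
  N := 1
  mass _ := 1
  spin _ := 0
  mass_pos _ := one_pos
  abs_spin_le_mass _ := by rw [abs_zero]; exact zero_le_one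
  motion _ := (1, 0)
  τ₀ := 0
  chart _ := Ψ
  isLateChart _ := isLateChart_Ψ
  tendsto_truncDeviationCk _ R := by
    simp_rw [truncDeviationCk_Ψ]
    exact tendsto_const_nhds
  exists_pairwise_disjoint _ := ⟨0, Subsingleton.pairwise⟩
  excision _ := ρ
  tendsto_excision_div _ := ρ_div_tendsto
  flatDomain := U
  setOf_lt_excision_subset_flatDomain := by
    rintro x ⟨hx0, hx⟩
    have h := hx 0
    rw [poincareInv_one_zero] at h
    exact ⟨by linarith, h⟩
  flatChart := Φ
  isLateChart_flat := isLateChart_Φ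
  tendsto_deviationCk_flat := by
    refine ST.tendsto_deviationCk_backgroundOn isLateChart_ΨK.contMDiff ?_
      ρ_tendsto_atTop (fun z (hz : z ∈ U) ↦ hz.2) hUext
    simp_rw [deviationCk_ΨK]
    exact tendsto_const_nhds
  diff_subset_causalPast := by
    rintro p ⟨hpO, hpn⟩
    -- `p⁰ ≤ 0`, otherwise `p` is hole-late charted
    have hp0 : p.1 0 ≤ 0 := by
      by_contra h
      push Not at h
      apply hpn
      refine Or.inl (mem_iUnion.mpr ⟨0, ?_⟩)
      obtain ⟨hp', hpeq⟩ := eq_Ψ p hpO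
      refine ⟨⟨p.1, hp'⟩, ?_, hpeq⟩
      show 0 < poincareInv 1 0 p.1 0
      rwa [poincareInv_one_zero]
    -- flow up to time `0`, landing on the initial hole slab
    set s : ℝ := -p.1 0 with hs
    have hs0 : 0 ≤ s := by linarith
    refine causalFuture_mono (singleton_subset_iff.mpr ?_) (mem_causalPast_up p hpO hs0)
    refine Or.inl (mem_iUnion.mpr ⟨(0 : Fin 1), ?_⟩)
    have hqO : up p s ∈ O := by rw [mem_O, radius_up]; exact hpO
    obtain ⟨hq', hqeq⟩ := eq_Ψ (up p s) hqO
    refine ⟨⟨(up p s).1, hq'⟩, ?_, hqeq⟩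
    show poincareInv 1 0 (up p s).1 0 = 0
    rw [poincareInv_one_zero, up_zero_apply, hs]
    ring

theorem decomp_N : decomp.N = 1 := rfl
theorem decomp_τ₀ : decomp.τ₀ = 0 := rfl
theorem decomp_background (i : Fin decomp.N) :
    decomp.background i = boostedKerrBackground 1 0 1 0 := rfl
theorem decomp_flatDomain : decomp.flatDomain = U := rfl
theorem decomp_flatChart : decomp.flatChart = Φ := rfl
theorem decomp_excision (i : Fin decomp.N) : decomp.excision i = ρ := rfl

@[simp] theorem bg_time (x : E4) : (boostedKerrBackground 1 0 1 0).time x = x 0 := by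
  show poincareInv 1 0 x 0 = x 0
  rw [poincareInv_one_zero]

@[simp] theorem bg_radius (x : E4) :
    (boostedKerrBackground 1 0 1 0).radius x = Kerr.radius 0 x := by
  show Kerr.radius 0 (poincareInv 1 0 x) = _
  rw [poincareInv_one_zero]

theorem Φ_mem_O (y : (Minkowski.backgroundOn U).domain) : Φ y ∈ O :=
  (two_lt_ρ (y.1 0)).trans y.2.2

/-- `HonestCore` (d) in the model: the flat chart is future oriented (the static flow). -/
theorem flat_isFutureDirected (y : decomp.flatDomain) (_hy : decomp.τ₀ < y.1 0) :
    ST.timeOrientation.IsFutureDirected (mfderiv 𝓘(ℝ, E4) (𝓡 4) decomp.flatChart y (E4.basisVector 0)) := by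
  have hrad : 2 * (1 : ℝ) < Kerr.radius 0 (Φ y).1 := Φ_mem_O y
  exact (congrArg (fun w : E4 ↦ ST.timeOrientation.IsFutureDirected (x := Φ y) w)
    (OpensChart.mfderiv_inclusion_apply hUreg y (E4.basisVector 0))).mpr
      (Schw.isFutureDirected_e0 (hM := zero_le_one) (Φ y) hrad)

/-- SEAMED (8) in the model for the radii `R = ρ + 2` (with equality on the tube walls). -/
theorem seamed8 (j : Fin decomp.N) (y : E4) (_hy : decomp.τ₀ ≤ y 0)
    (hr : (decomp.background j).radius y ≤ decomp.excision j (y 0)) :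
    (decomp.background j).radius y + 2 ≤ Rj ((decomp.background j).time y) := by
  rw [decomp_background, bg_radius, bg_time, Rj]
  rw [decomp_background, bg_radius, decomp_excision] at hr
  linarith

/-! ### The witness point `y = (1/4, 105.5, 0, 0)` -/

/-- The flat-late point `y = (1/4, ρ(1/4) + 4, 0, 0) = (1/4, 105.5, 0, 0)`. -/
def yJ : E4 := E4.ofTimeSpace (1 / 4) ((211 / 2 : ℝ) • EuclideanSpace.single (0 : Fin 3) (1 : ℝ))

theorem yJ_zero : yJ 0 = 1 / 4 := E4.ofTimeSpace_apply_zero _ _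

theorem spatialNorm_yJ : E4.spatialNorm yJ = 211 / 2 := by
  rw [yJ, E4.spatialNorm_ofTimeSpace, norm_smul, Real.norm_eq_abs, abs_of_pos (by norm_num)]
  simp

theorem radius_yJ : Kerr.radius 0 yJ = 211 / 2 := by rw [Kerr.radius_zero_left, spatialNorm_yJ]

theorem yJ_mem_U : yJ ∈ U := by
  refine ⟨by rw [yJ_zero]; norm_num, ?_⟩
  rw [radius_yJ, yJ_zero, ρ_quarter]
  norm_num

/-- Finite speed of light from `y`: a point `q` causally above `Φ y` with `q⁰ ≤ 1` has
`104.75 ≤ r(q) ≤ 106.25` and `q⁰ ≥ 1/4`. -/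
theorem radius_bounds_of_le {q : ST.carrier}
    (h : Φ ⟨yJ, yJ_mem_U⟩ ∈ ST.metric.causalPast ST.timeOrientation {q}) (hq1 : q.1 0 ≤ 1) :
    1 / 4 ≤ q.1 0 ∧ 419 / 4 ≤ Kerr.radius 0 q.1 ∧ Kerr.radius 0 q.1 ≤ 425 / 4 := by
  obtain ⟨q', hq', hle⟩ := KerrCone.exists_norm_spatial_sub_le_of_mem_causalPast h
  have hq'' : q' = q := hq'
  have hle' : ‖E4.spatial q.1 - E4.spatial yJ‖ ≤ q.1 0 - yJ 0 := by rw [← hq'']; exact hle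
  rw [yJ_zero] at hle'
  have htri1 : E4.spatialNorm q.1 - E4.spatialNorm yJ ≤ ‖E4.spatial q.1 - E4.spatial yJ‖ := by
    rw [E4.spatialNorm, E4.spatialNorm]
    exact norm_sub_norm_le _ _
  have htri2 : E4.spatialNorm yJ - E4.spatialNorm q.1 ≤ ‖E4.spatial q.1 - E4.spatial yJ‖ := by
    rw [E4.spatialNorm, E4.spatialNorm, norm_sub_rev]
    exact norm_sub_norm_le _ _
  rw [spatialNorm_yJ] at htri1 htri2
  rw [Kerr.radius_zero_left]
  have hn0 : 0 ≤ ‖E4.spatial q.1 - E4.spatial yJ‖ := norm_nonneg _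
  exact ⟨by linarith, by linarith, by linarith⟩

/-- LEFT fails: `Φ y` is NOT causally below the flat slab at chart time `1` (its points have
`r > ρ(1) = 112`, out of reach of light from `y`). -/
theorem Φ_yJ_not_mem_causalPast_flatSlab :
    Φ ⟨yJ, yJ_mem_U⟩ ∉ ST.metric.causalPast ST.timeOrientation
      (Φ '' (Minkowski.backgroundOn U).timeSlab 1) := by
  intro h
  obtain ⟨q, ⟨z, hz, rfl⟩, hle⟩ := KerrCone.exists_norm_spatial_sub_le_of_mem_causalPast h
  have hz0 : z.1 0 = 1 := hz
  have hzr : ρ 1 < E4.spatialNorm z.1 := by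
    have := z.2.2
    rwa [Kerr.radius_zero_left, hz0] at this
  rw [Φ_val, Φ_val, hz0, yJ_zero] at hle
  have htri : E4.spatialNorm z.1 - E4.spatialNorm yJ ≤ ‖E4.spatial z.1 - E4.spatial yJ‖ := by
    rw [E4.spatialNorm, E4.spatialNorm]
    exact norm_sub_norm_le _ _
  rw [spatialNorm_yJ] at htri
  rw [ρ_one] at hzr
  linarith

/-- RIGHT fails: no flat-domain point `c` with `c⁰ ≤ 1` causally above `Φ y` is a contact point for
the radii `R = ρ + 2`. -/
theorem no_contact (c : (Minkowski.backgroundOn U).domain) (hc1 : c.1 0 ≤ 1)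
    (hcr : Kerr.radius 0 c.1 ≤ Rj (c.1 0))
    (hyc : Φ ⟨yJ, yJ_mem_U⟩ ∈ ST.metric.causalPast ST.timeOrientation {Φ c}) : False := by
  obtain ⟨-, hlo, hhi⟩ := radius_bounds_of_le hyc (by rw [Φ_val]; exact hc1)
  rw [Φ_val] at hlo hhi
  rcases hc1.lt_or_eq with hlt | heq
  · have := Rj_le_of_lt_one hlt
    linarith
  · have hcU := c.2.2
    rw [heq, ρ_one] at hcU
    linarith

end JumpModel

/-- **Continuity of the radii (`hR`, SEAMED (1)) is load-bearing for the first-contact stub.** The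
statement of the landed theorem `WideAnchoring.stub_firstContact` (p76467) with its hypothesis
`hR : ∀ i, Continuous (R i)` DELETED is false: in the jump model (`JumpModel.decomp`: exact Schwarzschild
exterior of mass `1`, identity charts, flat tube radius `ρ(t) = 101 + √t + 10·𝟙[1 ≤ t]`; `hd` holds by
the static flow, SEAMED (8) holds for `R = ρ + 2`) take `τ₁ = 1` and `y = (1/4, 105.5, 0, 0)`: LEFT
fails (`Φ_yJ_not_mem_causalPast_flatSlab`) and RIGHT fails (`no_contact`), both by finite speed of
light in Kerr–Schild coordinates. Any counter-model must have a discontinuous excision radius (see the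
module docstring), so this also records that the stub holds with `hR` replaced by "some continuous
`R' ≤ R` satisfies (8)". Dafermos–Rodnianski arXiv:0811.0354, §5.1. [folklore] -/
theorem not_firstContact_without_continuity :
    ¬ ∀ (𝓢 : Spacetime.{0} 4) (O : Set 𝓢.carrier) (d : FinalStateDecomposition 𝓢 O 2)
        (R : Fin d.N → ℝ → ℝ),
      (∀ y : d.flatDomain, d.τ₀ < y.1 0 →
        𝓢.timeOrientation.IsFutureDirected
          (mfderiv 𝓘(ℝ, E4) (𝓡 4) d.flatChart y (E4.basisVector 0))) →
      (∀ j (y : E4), d.τ₀ ≤ y 0 → (d.background j).radius y ≤ d.excision j (y 0) →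
        (d.background j).radius y + 2 ≤ R j ((d.background j).time y)) →
      ∀ (τ₁ : ℝ) (y : d.flatDomain), d.τ₀ < y.1 0 → y.1 0 ≤ τ₁ →
        d.flatChart y ∈ 𝓢.metric.causalPast 𝓢.timeOrientation
            (d.flatChart '' (Minkowski.backgroundOn d.flatDomain).timeSlab τ₁) ∨
          ∃ (c : d.flatDomain) (k : Fin d.N), d.τ₀ < c.1 0 ∧ c.1 0 ≤ τ₁ ∧
            (d.background k).radius c.1 ≤ R k ((d.background k).time c.1) ∧
            d.flatChart y ∈ 𝓢.metric.causalPast 𝓢.timeOrientation {d.flatChart c} := by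
  intro h
  rcases h JumpModel.ST JumpModel.O JumpModel.decomp (fun _ ↦ JumpModel.Rj)
      JumpModel.flat_isFutureDirected JumpModel.seamed8 1 ⟨JumpModel.yJ, JumpModel.yJ_mem_U⟩
      (by show (0 : ℝ) < JumpModel.yJ 0; rw [JumpModel.yJ_zero]; norm_num)
      (by show JumpModel.yJ 0 ≤ 1; rw [JumpModel.yJ_zero]; norm_num) with hL | ⟨c, k, -, hc1, hcr, hyc⟩
  · exact JumpModel.Φ_yJ_not_mem_causalPast_flatSlab hL
  · rw [JumpModel.decomp_background, JumpModel.bg_radius, JumpModel.bg_time] at hcr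
    exact JumpModel.no_contact c hc1 hcr hyc

end Summit.FinalStateConjecture.FinalStateConjecture.Theorems.SeamedChartsExhaust.Negative

end
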